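import Summits.QuantumFields.QCD.Theses.WilsonQuarkChessboard
import Summits.QuantumFields.QCD.Theses.GradientFlowSpecies

/-!
# Crux `WilsonQuarkChessboard.MassiveBridge` (stmt-QuantumFields-17577), line `registered`, stub
`stub_latticeGapLaw` — reduction to the shared crux `GradientFlowSpecies.MassiveLatticeGap`
(stmt-QuantumFields-8922)

The gen-2 skeleton `Cruxes/MassiveBridge/Lines/birth.lean` cuts the crux into a UV law, a LATTICE GAP LAW and a
species clustering law.  The lattice gap law `LatticeGapLawStmt` reads: for `N_f ∈ {2,3}`, every regularisation
`reg` with `HasMassScaling` carrying full continuum data above an offset `M₀ ≥ 0` (for every tuple `m` with all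
`m_f > M₀`: species renormalisations `z, shift` and OS data `T` with `IsQCDAlong (reg.scheme m z shift) T`,
non-trivial non-Gaussian glue and non-trivial flavour-changing pseudoscalars) has a threshold `M₁ ≥ M₀` above
which every tuple has a volume-uniform lattice mass gap `∃ Δ > 0, (reg.scheme m 0 0).HasLatticeMassGap Δ`.  It
contains the weak-coupling lattice Yang–Mills mass gap along an asymptotically scaling sequence (open problem)
and is NOT proved here.

This file records, sorry-free and with all statements INLINED over the Statement's vocabulary (the skeleton's
`def`s live in a crux workfile and are not importable), that the stub is EQUIVALENT to the shared open item
`GradientFlowSpecies.MassiveLatticeGap` (stmt-QuantumFields-8922: the same law for OFFSET-FREE data `∀ m > 0`,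
with an unsigned threshold), whence the stub is exactly that item's debt:

* `massiveBridge_latticeGapLaw_iff_offsetFree` — OFFSET NORMAL FORM: the law for every offset `M₀ ≥ 0` is
  equivalent to the law for offset-free data with a threshold `M₁ ≥ 0` (`→`: take `M₀ = 0`; `←`: shift the
  critical bare mass `m_crit(k) ↦ m_crit(k) + a_k M₀ / Z_m(k)`, which realises the tuple `m` literally as `reg`
  realises `m + M₀` — the content of item stmt-QuantumFields-8924 `GradientFlowSpecies.OffsetShift` (proved in
  `Theorems/GradientFlowSpeciesOffsetShift.lean`; the three-line proof is repeated here as the private lemma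
  `latticeGapLaw_schemeOffsetShift` to keep this file's imports to the two Theses files) — and leaves `Z_m`,
  hence `HasMassScaling`, untouched; the lattice gap found at `m - M₀` for the shifted regularisation is the
  lattice gap of `reg` at `m`);
* `massiveBridge_latticeGapLaw_offsetFree_iff_massiveLatticeGap` — the offset-free form IS item 8922 (the sign
  of the threshold is immaterial: `M ↦ max M 0`);
* `massiveBridge_latticeGapLaw_iff_massiveLatticeGap`, `massiveBridge_latticeGapLaw_of_massiveLatticeGap` — the
  composition `LatticeGapLawStmt ↔ MassiveLatticeGap`, in particular `MassiveLatticeGap → LatticeGapLawStmt`.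

References: Montvay–Münster 1994 §5.1 (critical hopping parameter; the additive mass renormalisation of Wilson
fermions is flavour-blind, so a flavour-blind offset of `m_crit` is a shift of all renormalised masses);
Jaffe–Witten 2000 §5 (uniform gap of the finite-volume / lattice approximants); Osterwalder–Seiler 1978 §§2–4.
-/

namespace Summit.QuantumFields.QCD.Theorems

open Literature.MathematicalPhysics.QuantumFieldTheory

/-- **The offset shift of a regularisation** (the content of item stmt-QuantumFields-8924
`GradientFlowSpecies.OffsetShift`, proved in the tree as `Summit.QuantumFields.QCD.Theorems.offsetShift_proof`;
repeated verbatim to keep the import cone small): shifting the flavour-blind critical bare mass `m_crit(k)` by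
`a_k M / Z_m(k)` realises the tuple `m` exactly as `reg` realises `m + M` — both schemes have bare masses
`m_crit(k) + a_k (m_f + M) / Z_m(k)`, every other datum (`a, β, L, z, shift`) is untouched.  Definitional
(`ring`). [cite: MontvayMunster1994, §5.1] -/
private theorem latticeGapLaw_schemeOffsetShift {Nf : ℕ} (reg : QCDRegularisation Nf) (M : ℝ)
    (m : Fin Nf → ℝ) (z shift : QCDField Nf → ℕ → ℝ) :
    ({ reg with mcrit := fun k => reg.mcrit k + reg.a k * M / reg.Zm k } : QCDRegularisation Nf).scheme m z
        shift = reg.scheme (fun f => m f + M) z shift := by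
  simp only [QCDRegularisation.scheme, QCDScheme.mk.injEq, true_and, and_true]
  funext f k
  ring

/-- **Offset normal form of the lattice gap law.**  For `N_f ∈ {2,3}` and regularisations with
`HasMassScaling`: "for every offset `M₀ ≥ 0`, full continuum data above `M₀` give a threshold `M₁ ≥ M₀` above
which every tuple has a uniform lattice gap `∃ Δ > 0, (reg.scheme m 0 0).HasLatticeMassGap Δ`" is equivalent to
the same law for OFFSET-FREE data (`∀ m > 0`, the hypothesis shape of the shared crux
`GradientFlowSpecies.MassiveLatticeGap`) with a threshold `M₁ ≥ 0`.  `→`: specialise to `M₀ = 0`.  `←`: the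
regularisation with critical mass `m_crit(k) + a_k M₀ / Z_m(k)` has the same `Z_m` (so the same mass scaling) and
realises the tuple `m` literally as `reg` realises `m + M₀` (the `m_crit` offset shift, item 8924); it
therefore carries offset-free data, gets a threshold `M₁`, and its lattice gap at `m - M₀` (`m > M₁ + M₀`) is the
lattice gap of `reg` at `m`. [cite: MontvayMunster1994, §5.1] [cite: JaffeWitten2000, §5] -/
theorem massiveBridge_latticeGapLaw_iff_offsetFree :
    (∀ Nf : ℕ, Nf = 2 ∨ Nf = 3 → ∀ (reg : QCDRegularisation Nf) (M₀ : ℝ), reg.HasMassScaling → 0 ≤ M₀ →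
      (∀ m : Fin Nf → ℝ, (∀ f, M₀ < m f) →
        ∃ (z shift : QCDField Nf → ℕ → ℝ) (T : OSData (QCDField Nf) 4),
          IsQCDAlong (reg.scheme m z shift) T ∧ T.IsNontrivial QCDField.glue ∧
            T.IsNonGaussian QCDField.glue ∧
              ∀ f g : Fin Nf, f ≠ g → T.IsNontrivial (QCDField.pseudoRe f g)) →
      ∃ M₁ : ℝ, M₀ ≤ M₁ ∧ ∀ m : Fin Nf → ℝ, (∀ f, M₁ < m f) →
        ∃ Δ : ℝ, 0 < Δ ∧ (reg.scheme m 0 0).HasLatticeMassGap Δ) ↔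
    (∀ Nf : ℕ, Nf = 2 ∨ Nf = 3 → ∀ reg : QCDRegularisation Nf, reg.HasMassScaling →
      (∀ m : Fin Nf → ℝ, (∀ f, 0 < m f) →
        ∃ (z shift : QCDField Nf → ℕ → ℝ) (T : OSData (QCDField Nf) 4),
          IsQCDAlong (reg.scheme m z shift) T ∧ T.IsNontrivial QCDField.glue ∧
            T.IsNonGaussian QCDField.glue ∧
              ∀ f g : Fin Nf, f ≠ g → T.IsNontrivial (QCDField.pseudoRe f g)) →
      ∃ M₁ : ℝ, 0 ≤ M₁ ∧ ∀ m : Fin Nf → ℝ, (∀ f, M₁ < m f) →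
        ∃ Δ : ℝ, 0 < Δ ∧ (reg.scheme m 0 0).HasLatticeMassGap Δ) := by
  constructor
  · -- specialise the offset to `M₀ = 0`
    intro h Nf hNf reg hms hdata
    exact h Nf hNf reg 0 hms le_rfl hdata
  · -- shift the offset into the critical mass
    intro h Nf hNf reg M₀ hms hM₀ hdata
    set reg' : QCDRegularisation Nf :=
      { reg with mcrit := fun k => reg.mcrit k + reg.a k * M₀ / reg.Zm k } with hreg'
    -- the shifted regularisation realises `m` as `reg` realises `m + M₀` (item 8924)
    have hsch : ∀ (m : Fin Nf → ℝ) (z shift : QCDField Nf → ℕ → ℝ),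
        reg'.scheme m z shift = reg.scheme (fun f => m f + M₀) z shift := fun m z shift => by
      rw [hreg']
      exact latticeGapLaw_schemeOffsetShift reg M₀ m z shift
    -- `Z_m` is untouched, so is the mass scaling
    have hms' : reg'.HasMassScaling := hms
    -- the shifted regularisation carries offset-free data
    have hdata' : ∀ m : Fin Nf → ℝ, (∀ f, 0 < m f) →
        ∃ (z shift : QCDField Nf → ℕ → ℝ) (T : OSData (QCDField Nf) 4),
          IsQCDAlong (reg'.scheme m z shift) T ∧ T.IsNontrivial QCDField.glue ∧
            T.IsNonGaussian QCDField.glue ∧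
              ∀ f g : Fin Nf, f ≠ g → T.IsNontrivial (QCDField.pseudoRe f g) := by
      intro m hm
      obtain ⟨z, shift, T, hqcd, hglue, hng, hps⟩ := hdata (fun f => m f + M₀) fun f => by
        have := hm f
        linarith
      exact ⟨z, shift, T, by rwa [hsch], hglue, hng, hps⟩
    obtain ⟨M₁, hM₁, hm⟩ := h Nf hNf reg' hms' hdata'
    refine ⟨M₁ + M₀, by linarith, fun m hmm => ?_⟩
    have hmm' : ∀ f, M₁ < (fun f => m f - M₀) f := fun f => by
      have := hmm f
      simp only
      linarith
    obtain ⟨Δ, hΔ, hgap⟩ := hm (fun f => m f - M₀) hmm'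
    have hback : reg'.scheme (fun f => m f - M₀) 0 0 = reg.scheme m 0 0 := by
      rw [hsch]
      simp only [sub_add_cancel]
    exact ⟨Δ, hΔ, by rwa [hback] at hgap⟩

/-- **The offset-free lattice gap law IS item stmt-QuantumFields-8922.**  The offset-free form (hypotheses
`HasMassScaling` and offset-free full continuum data, curried; threshold `M₁ ≥ 0`) is equivalent to
`GradientFlowSpecies.MassiveLatticeGap` (the same hypotheses as a conjunction; unsigned threshold `M`): a
threshold may always be raised, `M ↦ max M 0`. [cite: JaffeWitten2000, §5] -/
theorem massiveBridge_latticeGapLaw_offsetFree_iff_massiveLatticeGap :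
    (∀ Nf : ℕ, Nf = 2 ∨ Nf = 3 → ∀ reg : QCDRegularisation Nf, reg.HasMassScaling →
      (∀ m : Fin Nf → ℝ, (∀ f, 0 < m f) →
        ∃ (z shift : QCDField Nf → ℕ → ℝ) (T : OSData (QCDField Nf) 4),
          IsQCDAlong (reg.scheme m z shift) T ∧ T.IsNontrivial QCDField.glue ∧
            T.IsNonGaussian QCDField.glue ∧
              ∀ f g : Fin Nf, f ≠ g → T.IsNontrivial (QCDField.pseudoRe f g)) →
      ∃ M₁ : ℝ, 0 ≤ M₁ ∧ ∀ m : Fin Nf → ℝ, (∀ f, M₁ < m f) →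
        ∃ Δ : ℝ, 0 < Δ ∧ (reg.scheme m 0 0).HasLatticeMassGap Δ) ↔
    Summit.QuantumFields.QCD.Theses.GradientFlowSpecies.MassiveLatticeGap := by
  constructor
  · intro h Nf hNf reg hreg
    obtain ⟨M₁, -, hm⟩ := h Nf hNf reg hreg.1 hreg.2
    exact ⟨M₁, hm⟩
  · intro h Nf hNf reg hms hdata
    obtain ⟨M, hM⟩ := h Nf hNf reg ⟨hms, hdata⟩
    exact ⟨max M 0, le_max_right _ _, fun m hm => hM m fun f => (le_max_left M 0).trans_lt (hm f)⟩

/-- **The lattice gap law of the crux `MassiveBridge` is equivalent to the shared crux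
`GradientFlowSpecies.MassiveLatticeGap` (stmt-QuantumFields-8922).**  For `N_f ∈ {2,3}`: "every regularisation
with `HasMassScaling` and full continuum data above an offset `M₀ ≥ 0` has a threshold `M₁ ≥ M₀` above which every
tuple has a uniform lattice gap `∃ Δ > 0, (reg.scheme m 0 0).HasLatticeMassGap Δ`" `↔` "every regularisation with
`HasMassScaling` and offset-free full continuum data has a threshold above which every tuple has such a gap".
Offset normal form (`massiveBridge_latticeGapLaw_iff_offsetFree`, the `m_crit` shift of Montvay–Münster §5.1)
followed by `massiveBridge_latticeGapLaw_offsetFree_iff_massiveLatticeGap`.  The common content is the lattice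
Yang–Mills gap plus heavy-quark decoupling, uniformly in the volume (Jaffe–Witten §5), proved by neither side.
[cite: MontvayMunster1994, §5.1] [cite: JaffeWitten2000, §5] -/
theorem massiveBridge_latticeGapLaw_iff_massiveLatticeGap :
    (∀ Nf : ℕ, Nf = 2 ∨ Nf = 3 → ∀ (reg : QCDRegularisation Nf) (M₀ : ℝ), reg.HasMassScaling → 0 ≤ M₀ →
      (∀ m : Fin Nf → ℝ, (∀ f, M₀ < m f) →
        ∃ (z shift : QCDField Nf → ℕ → ℝ) (T : OSData (QCDField Nf) 4),
          IsQCDAlong (reg.scheme m z shift) T ∧ T.IsNontrivial QCDField.glue ∧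
            T.IsNonGaussian QCDField.glue ∧
              ∀ f g : Fin Nf, f ≠ g → T.IsNontrivial (QCDField.pseudoRe f g)) →
      ∃ M₁ : ℝ, M₀ ≤ M₁ ∧ ∀ m : Fin Nf → ℝ, (∀ f, M₁ < m f) →
        ∃ Δ : ℝ, 0 < Δ ∧ (reg.scheme m 0 0).HasLatticeMassGap Δ) ↔
    Summit.QuantumFields.QCD.Theses.GradientFlowSpecies.MassiveLatticeGap :=
  massiveBridge_latticeGapLaw_iff_offsetFree.trans massiveBridge_latticeGapLaw_offsetFree_iff_massiveLatticeGap

/-- **Item stmt-QuantumFields-8922 implies the lattice gap law of `MassiveBridge`** (the direction the crux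
composition `Birth.MassiveBridge_of` consumes): if every `N_f ∈ {2,3}` regularisation with `HasMassScaling` and
offset-free full continuum data is lattice-gapped above a threshold (`GradientFlowSpecies.MassiveLatticeGap`), then
every such regularisation with data above an offset `M₀ ≥ 0` is lattice-gapped above some `M₁ ≥ M₀` — by the
`m_crit` offset shift. [cite: MontvayMunster1994, §5.1] [cite: JaffeWitten2000, §5] -/
theorem massiveBridge_latticeGapLaw_of_massiveLatticeGap :
    Summit.QuantumFields.QCD.Theses.GradientFlowSpecies.MassiveLatticeGap →
      ∀ Nf : ℕ, Nf = 2 ∨ Nf = 3 → ∀ (reg : QCDRegularisation Nf) (M₀ : ℝ), reg.HasMassScaling → 0 ≤ M₀ →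
        (∀ m : Fin Nf → ℝ, (∀ f, M₀ < m f) →
          ∃ (z shift : QCDField Nf → ℕ → ℝ) (T : OSData (QCDField Nf) 4),
            IsQCDAlong (reg.scheme m z shift) T ∧ T.IsNontrivial QCDField.glue ∧
              T.IsNonGaussian QCDField.glue ∧
                ∀ f g : Fin Nf, f ≠ g → T.IsNontrivial (QCDField.pseudoRe f g)) →
        ∃ M₁ : ℝ, M₀ ≤ M₁ ∧ ∀ m : Fin Nf → ℝ, (∀ f, M₁ < m f) →
          ∃ Δ : ℝ, 0 < Δ ∧ (reg.scheme m 0 0).HasLatticeMassGap Δ :=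
  massiveBridge_latticeGapLaw_iff_massiveLatticeGap.2

end Summit.QuantumFields.QCD.Theorems
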